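import Literature.Probability.RandomPlanarGeometry.HexSAWStripSurfaceBridgeNull
import HarnessLib

/-!
# The critical arch series of a strip in the wide-strip limit, WITHOUT the radius input `y_c < y_T`:
# `cos(3π/8)·A_T(x_c, y*) → 1` as `T → ∞`, with the explicit defect bound `0 ≤ 1 − cos(3π/8)·A_{T+1}(x_c, y*) ≤ B_T(x_c, 1)`

Objects are the tree's (Duminil-Copin–Smirnov strip domains `S_{T,L}`, surface weight `y` per contact with the far boundary):
`HV.stripGFy T L IsAlphaDart y = A_{T,L}(x_c; y)`, `HV.stripAyLim T y = A_T(x_c; y) := sup_L A_{T,L}(x_c; y)`,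
`HV.stripA T L x_c = A_{T,L}(x_c; 1)`, `HV.stripAlim T = A_T(x_c; 1)`, `HV.stripBlim T = B_T(x_c; 1)`, `HV.yStar = y* = 1 + √2`,
`HV.betaY y = β(y) = (1 + √2 − y)/(√2 y)`.  Source: N. R. Beaton, M. Bousquet-Mélou, J. de Gier, H. Duminil-Copin, A. J. Guttmann,
*The critical fugacity for surface adsorption of self-avoiding walks on the honeycomb lattice is `1 + √2`*, Comm. Math. Phys. 326
(2014) 727–754, arXiv:1109.0358 (page numbers = arXiv v5): §4.1 eq. (16) (p. 13), §4.2 (p. 14: «the above identity shows that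
A_{T,L}(x_c; y*) remains bounded as L increases. Hence the limit lim_{L→∞} A_{T,L}(x_c; y*) exists and is finite»), §4.3 eq. (18) at
`y = 1`: `αA_T(x_c, 1) + B_T(x_c, 1) = 1` (p. 14: «the case y = 1 of (18)»; displayed on p. 15; = the tree's `HV.strip_identity_lim`), §4.4 eq. (19)
with Theorem 10: `A(x_c) = 1/α` (p. 14), Theorem 10 `B_T(x_c, 1) → 0` with Remark 1 (p. 14: «We can actually prove that A_T(x_c, y) → A(x_c)
for y < y*»), §4.5 (p. 15: «The series A_{T+1}(x_c, y) counts arches of height at most T+1. This includes arches of height at most T,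
which have no contacts with the top boundary»).  Secondary: N. R. Beaton, A. J. Guttmann, I. Jensen, J. Phys. A 45 (2012) 055208,
arXiv:1110.6695, §2 eq. (4) (p. 4: «1 = cos(3π/8) A_T(x_c, y_c)» for every width `T`); A. Glazman, I. Manolescu, arXiv:1804.06845,
Proposition 1.1 (`B_T(x_c) → 0`, rate `(ln T)^{-1/3}`).

WHAT IS PROVED (all `T ≥ 1`, no hypothesis on the radius `y_T`).  Write `δ_T := 1 − cos(3π/8)·A_T(x_c; y*)` (`≥ 0` by §4.2 at `y = y*`).
* `stripA_le_stripAyLim_succ_yStar`, `stripAlim_le_stripAyLim_succ_yStar` : `A_{T,L}(x_c; 1) ≤ A_{T+1}(x_c; y*)` and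
  `A_T(x_c; 1) ≤ A_{T+1}(x_c; y*)` (§4.5's inclusion of the contact-free arches, in the limit; §4.2's boundedness at `y*` gives the sup).
* ★ `one_sub_stripBlim_le_cos_mul_stripAyLim_succ_yStar` : `1 − B_T(x_c; 1) ≤ cos(3π/8)·A_{T+1}(x_c; y*) ≤ 1`, i.e.
  ★ `one_sub_cos_mul_stripAyLim_succ_yStar_mem_Icc` : `0 ≤ δ_{T+1} ≤ B_T(x_c; 1)` (by (18) at `y = 1`); with the Glazman–Manolescu rate
  `one_sub_cos_mul_stripAyLim_succ_yStar_le_log` : `δ_{T+1} ≤ 5 (ln T)^{-1/3}` (`T ≥ 2`); and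
  `stripAyLim_succ_yStar_sub_stripAlim_le_div` : `0 ≤ A_{T+1}(x_c; y*) − A_T(x_c; 1) ≤ B_T(x_c; 1)/cos(3π/8)`.
* ★ `tendsto_cos_mul_stripAyLim_succ_yStar` : `cos(3π/8)·A_{T+1}(x_c; y*) → 1` and ★ `tendsto_stripAyLim_succ_yStar` :
  `A_{T+1}(x_c; y*) → 1/cos(3π/8) = A(x_c)` as `T → ∞` — the ENDPOINT `y = y*` of §4.4 Remark 1 (printed for `y < y*`; the tree's
  `HV.tendsto_stripAyLim`), obtained here by the squeeze `A_T(x_c; 1) ≤ A_{T+1}(x_c; y*) ≤ 1/cos(3π/8)` and Theorem 10, hence WITHOUT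
  Corollary 8's `y_c < y_T` (with that input print has `δ_T = 0` for every `T`: BGJ12-Ads eq. (4); in the tree's hypothesis-form this is
  the lane's `cos(3π/8)·A_T(x_c; y*) = 1` under `y* < y_T`).  So: whatever the status of the strict radius inequality in the tree, the
  critical defect `δ_T` is squeezed to `0` in the wide-strip limit at the bridge rate.
No `sorry`, no new axioms.  Faithfulness: CONSOLIDATION of the printed inequalities (§4.2 at `y*`, §4.5 inclusion, (18) at `y = 1`) in the limit;
the unconditional endpoint limit and the defect bound `δ_{T+1} ≤ B_T(x_c; 1)` are not printed as such (print has `δ_T = 0`) — an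
elementary lane corollary, NEW-IN-WRITING at most; no novelty about SAWs is claimed.
-/

noncomputable section

open Filter Topology

namespace Literature.Probability.RandomPlanarGeometry.SAW.HV

variable {T : ℕ}

/-! ### §4.2 at `y = y*`: `A_{T,L}(x_c; y*) ≤ 1/cos(3π/8)` (private plumbing; the lane's Part IV `HexSAWStripSurfaceCriticalArch` (tree, p371907) states these publicly — import it at leisure once its olean serves) -/

/-- `β(y*) = 0`. [folklore] -/
private theorem betaY_yStar_zero_aux : betaY yStar = 0 := by
  unfold betaY yStar; simp

/-- `A_{T,L}(x_c; y*) ≤ 1/cos(3π/8)` (`T ≥ 1`): identity (16) at `y = y*` reads `1 = αA_{T,L} + εE_{T,L}` with `ε E ≥ 0`.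
[cite: BeatonBousquetMelouDeGierDuminilCopinGuttmann2014, §4.2 (arXiv v5 p. 14: "A_{T,L}(x_c; y*) remains bounded as L increases")] -/
private theorem stripGFy_alpha_yStar_le_aux (hT : 1 ≤ T) (L : ℕ) :
    stripGFy T L IsAlphaDart yStar ≤ 1 / Real.cos (3 * Real.pi / 8) := by
  have hid := stripIdentityY_holds T L yStar hT yStar_pos
  rw [betaY_yStar_zero_aux, zero_mul, add_zero] at hid
  have hE : 0 ≤ stripGFy T L (IsEpsDart L) yStar := stripGFy_nonneg' T L (IsEpsDart L) yStar_pos.le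
  have hc : 0 < Real.cos (3 * Real.pi / 8) := cos_three_pi_div_eight_pos
  have hε : 0 < Real.cos (Real.pi / 4) := cos_pi_div_four_pos'
  rw [le_div_iff₀ hc]
  nlinarith [mul_nonneg hε.le hE]

/-- The range of `L ↦ A_{T,L}(x_c; y*)` is bounded above (`T ≥ 1`). [cite: BeatonBousquetMelouDeGierDuminilCopinGuttmann2014, §4.2 (arXiv v5 p. 14)] -/
private theorem bddAbove_stripGFy_alpha_yStar_aux (hT : 1 ≤ T) :
    BddAbove (Set.range fun L : ℕ => stripGFy T L IsAlphaDart yStar) :=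
  ⟨_, by rintro _ ⟨L, rfl⟩; exact stripGFy_alpha_yStar_le_aux hT L⟩

/-- `cos(3π/8)·A_T(x_c; y*) ≤ 1` (`T ≥ 1`), i.e. `δ_T ≥ 0` (PRIVATE plumbing: the same statement is the tree's public
`HV.cos_mul_stripAyLim_yStar_le_one` in `HexSAWStripSurfaceCriticalArch` (Part IV, p371907), olean not served at authoring time — swap for
that import at leisure). [cite: BeatonBousquetMelouDeGierDuminilCopinGuttmann2014, §4.2 (arXiv v5 p. 14: "Hence the limit lim_{L→∞} A_{T,L}(x_c; y*) exists and is finite")] -/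
private theorem cos_mul_stripAyLim_yStar_le_one_aux (hT : 1 ≤ T) : Real.cos (3 * Real.pi / 8) * stripAyLim T yStar ≤ 1 := by
  have hc : 0 < Real.cos (3 * Real.pi / 8) := cos_three_pi_div_eight_pos
  have h : stripAyLim T yStar ≤ 1 / Real.cos (3 * Real.pi / 8) := ciSup_le fun L => stripGFy_alpha_yStar_le_aux hT L
  rw [le_div_iff₀ hc] at h
  linarith [mul_comm (Real.cos (3 * Real.pi / 8)) (stripAyLim T yStar)]

/-! ### §4.5's inclusion in the limit: `A_T(x_c; 1) ≤ A_{T+1}(x_c; y*)` -/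

/-- `A_{T,L}(x_c; 1) ≤ A_{T+1}(x_c; y*)` (`T ≥ 1`): every arch of `S_{T,L}` is an arch of `S_{T+1,L}` with no top contact
(tree `stripA_le_stripGFy_alpha_succ`), and `A_{T+1,L}(x_c; y*) ≤ A_{T+1}(x_c; y*)` (bounded sup, §4.2).
[cite: BeatonBousquetMelouDeGierDuminilCopinGuttmann2014, §4.5 (arXiv v5 p. 15: "This includes arches of height at most T, which have no contacts with the top boundary") and §4.2 (p. 14)] -/
theorem stripA_le_stripAyLim_succ_yStar (hT : 1 ≤ T) (L : ℕ) :
    stripA T L hexCriticalFugacity ≤ stripAyLim (T + 1) yStar :=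
  (stripA_le_stripGFy_alpha_succ T L yStar_pos.le).trans
    (le_ciSup (bddAbove_stripGFy_alpha_yStar_aux (T := T + 1) (by omega)) L)

/-- **`A_T(x_c; 1) ≤ A_{T+1}(x_c; y*)`** (`T ≥ 1`), unconditionally. [cite: BeatonBousquetMelouDeGierDuminilCopinGuttmann2014, §4.5 (arXiv v5 p. 15) with §4.2 (p. 14); lane corollary in the limit] -/
theorem stripAlim_le_stripAyLim_succ_yStar (hT : 1 ≤ T) : stripAlim T ≤ stripAyLim (T + 1) yStar :=
  ciSup_le fun L => stripA_le_stripAyLim_succ_yStar hT L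

/-- `A_{T+1}(x_c; y*)` lies in `[A_T(x_c; 1), 1/cos(3π/8)]` (`T ≥ 1`). [cite: BeatonBousquetMelouDeGierDuminilCopinGuttmann2014, §4.2 (arXiv v5 p. 14) and §4.5 (p. 15)] -/
theorem stripAyLim_succ_yStar_mem_Icc (hT : 1 ≤ T) :
    stripAyLim (T + 1) yStar ∈ Set.Icc (stripAlim T) (1 / Real.cos (3 * Real.pi / 8)) := by
  refine ⟨stripAlim_le_stripAyLim_succ_yStar hT, ?_⟩
  have hc : 0 < Real.cos (3 * Real.pi / 8) := cos_three_pi_div_eight_pos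
  have h := cos_mul_stripAyLim_yStar_le_one_aux (T := T + 1) (by omega)
  rw [le_div_iff₀ hc]; linarith

/-! ### The defect bound `0 ≤ δ_{T+1} ≤ B_T(x_c; 1)` and its consequences -/

/-- ★ **`1 − B_T(x_c; 1) ≤ cos(3π/8)·A_{T+1}(x_c; y*)`** (`T ≥ 1`): `cos(3π/8)·A_T(x_c; 1) = 1 − B_T(x_c; 1)` by (18) at `y = 1` and
`A_T(x_c; 1) ≤ A_{T+1}(x_c; y*)`. [cite: BeatonBousquetMelouDeGierDuminilCopinGuttmann2014, (18) at y = 1 (arXiv v5 p. 14: "the case y = 1 of (18)"; p. 15 display "αA_{T+1}(x_c; y_c) + β(y_c)B_{T+1}(x_c; y_c) = 1 = αA_T(x_c; 1) + B_T(x_c; 1)") and §4.5 (p. 15); GlazmanManolescu2019, Corollary 2.3 (the strip identity, tree `strip_identity_lim`); lane corollary] -/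
theorem one_sub_stripBlim_le_cos_mul_stripAyLim_succ_yStar (hT : 1 ≤ T) :
    1 - stripBlim T ≤ Real.cos (3 * Real.pi / 8) * stripAyLim (T + 1) yStar := by
  have hid := strip_identity_lim hT
  have hle := stripAlim_le_stripAyLim_succ_yStar hT
  have hc : 0 < Real.cos (3 * Real.pi / 8) := cos_three_pi_div_eight_pos
  nlinarith [mul_le_mul_of_nonneg_left hle hc.le]

/-- ★ **The critical defect of the `(T+1)`-strip is at most the critical bridge series of the `T`-strip:
`0 ≤ 1 − cos(3π/8)·A_{T+1}(x_c; y*) ≤ B_T(x_c; 1)`** (`T ≥ 1`), unconditionally (in print the middle term is `0`: BGJ12-Ads eq. (4)).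
[cite: BeatonBousquetMelouDeGierDuminilCopinGuttmann2014, §4.2 (arXiv v5 p. 14), (18) at y = 1 (p. 14: "the case y = 1 of (18)"; p. 15 display), §4.5 (p. 15); BeatonGuttmannJensen2012Adsorption, §2 eq. (4) (arXiv p. 4: "1 = cos(3π/8) A_T(x_c, y_c)"); lane corollary, not printed as such] -/
theorem one_sub_cos_mul_stripAyLim_succ_yStar_mem_Icc (hT : 1 ≤ T) :
    1 - Real.cos (3 * Real.pi / 8) * stripAyLim (T + 1) yStar ∈ Set.Icc 0 (stripBlim T) := by
  refine ⟨?_, ?_⟩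
  · linarith [cos_mul_stripAyLim_yStar_le_one_aux (T := T + 1) (by omega)]
  · linarith [one_sub_stripBlim_le_cos_mul_stripAyLim_succ_yStar hT]

/-- `0 ≤ A_{T+1}(x_c; y*) − A_T(x_c; 1) ≤ B_T(x_c; 1)/cos(3π/8)` (`T ≥ 1`), unconditionally (with `y_c < y_{T+1}` the lane's Part IV has
equality). [cite: BeatonBousquetMelouDeGierDuminilCopinGuttmann2014, (18) at y = 1 (arXiv v5 p. 14: "the case y = 1 of (18)"; p. 15 display), §4.2 (p. 14), §4.5 (p. 15); lane corollary] -/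
theorem stripAyLim_succ_yStar_sub_stripAlim_le_div (hT : 1 ≤ T) :
    0 ≤ stripAyLim (T + 1) yStar - stripAlim T ∧
      stripAyLim (T + 1) yStar - stripAlim T ≤ stripBlim T / Real.cos (3 * Real.pi / 8) := by
  have hc : 0 < Real.cos (3 * Real.pi / 8) := cos_three_pi_div_eight_pos
  refine ⟨sub_nonneg.2 (stripAlim_le_stripAyLim_succ_yStar hT), ?_⟩
  have hid := strip_identity_lim hT
  have h1 := cos_mul_stripAyLim_yStar_le_one_aux (T := T + 1) (by omega)
  rw [le_div_iff₀ hc]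
  nlinarith

/-- `δ_{T+1} ≤ 5 (ln T)^{-1/3}` for `T ≥ 2`: the defect bound composed with the tree's Glazman–Manolescu decay
`hexBridgeLogDecay : B_T(x_c) ≤ 5 (ln T)^{-1/3}`. [cite: GlazmanManolescu2019, Proposition 1.1 (arXiv v3: B_T(x_c) → 0, (log T)^{-1/3} rate of §4); BeatonBousquetMelouDeGierDuminilCopinGuttmann2014, §4.2/§4.5 and (18) at y = 1 (arXiv v5 pp. 14–15); lane corollary] -/
theorem one_sub_cos_mul_stripAyLim_succ_yStar_le_log (hT : 2 ≤ T) :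
    1 - Real.cos (3 * Real.pi / 8) * stripAyLim (T + 1) yStar ≤ 5 * Real.log T ^ (-(1 : ℝ) / 3) :=
  (one_sub_cos_mul_stripAyLim_succ_yStar_mem_Icc (T := T) (by omega)).2.trans (hexBridgeLogDecay T hT)

/-- ★ **`cos(3π/8)·A_{T+1}(x_c; y*) → 1` as `T → ∞`**, unconditionally: squeeze between `1 − B_T(x_c; 1) → 1` (Theorem 10,
tree `tendsto_stripBlim`) and `1`. [cite: BeatonBousquetMelouDeGierDuminilCopinGuttmann2014, Theorem 10 and §4.4 Remark 1 (arXiv v5 p. 14); GlazmanManolescu2019, Proposition 1.1; lane corollary at the endpoint y = y*] -/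
theorem tendsto_cos_mul_stripAyLim_succ_yStar :
    Tendsto (fun T : ℕ => Real.cos (3 * Real.pi / 8) * stripAyLim (T + 1) yStar) atTop (𝓝 1) := by
  have hlow : Tendsto (fun T : ℕ => 1 - stripBlim T) atTop (𝓝 1) := by
    have h := tendsto_stripBlim.const_sub 1
    rw [sub_zero] at h
    exact h
  refine tendsto_of_tendsto_of_tendsto_of_le_of_le' hlow tendsto_const_nhds ?_ ?_
  · filter_upwards [eventually_ge_atTop 1] with T hT using one_sub_stripBlim_le_cos_mul_stripAyLim_succ_yStar hT
  · filter_upwards [eventually_ge_atTop 1] with T hT using cos_mul_stripAyLim_yStar_le_one_aux (T := T + 1) (by omega)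

/-- ★ **`A_{T+1}(x_c; y*) → 1/cos(3π/8) = A(x_c)` as `T → ∞`** — the endpoint `y = y*` of BBdGDCG's Remark 1, unconditionally
(for `0 < y < y*` this is the tree's `tendsto_stripAyLim`). [cite: BeatonBousquetMelouDeGierDuminilCopinGuttmann2014, §4.4 Remark 1 (arXiv v5 p. 14: "We can actually prove that A_T(x_c, y) → A(x_c) for y < y*") — endpoint case, lane corollary; BeatonGuttmannJensen2012Adsorption, §2 eq. (4) (arXiv p. 4)] -/
theorem tendsto_stripAyLim_succ_yStar :
    Tendsto (fun T : ℕ => stripAyLim (T + 1) yStar) atTop (𝓝 (1 / Real.cos (3 * Real.pi / 8))) := by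
  have hc : 0 < Real.cos (3 * Real.pi / 8) := cos_three_pi_div_eight_pos
  have h := tendsto_cos_mul_stripAyLim_succ_yStar.const_mul (Real.cos (3 * Real.pi / 8))⁻¹
  rw [mul_one, ← one_div] at h
  refine h.congr fun T => ?_
  field_simp

/-- `A_{T+1}(x_c; y*) − A_T(x_c; 1) → 0` as `T → ∞`, unconditionally (both tend to `A(x_c) = 1/cos(3π/8)`).
[cite: BeatonBousquetMelouDeGierDuminilCopinGuttmann2014, §4.4 Remark 1 and eq. (19) with Theorem 10: A(x_c) = 1/α (arXiv v5 p. 14); lane corollary] -/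
theorem tendsto_stripAyLim_succ_yStar_sub_stripAlim :
    Tendsto (fun T : ℕ => stripAyLim (T + 1) yStar - stripAlim T) atTop (𝓝 0) := by
  have h := tendsto_stripAyLim_succ_yStar.sub tendsto_stripAlim
  rw [one_div, sub_self] at h
  exact h

end Literature.Probability.RandomPlanarGeometry.SAW.HV
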